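import Literature.AnabelianGeometry.AbsoluteAnabelian.NeukirchUchidaPrimeCorrespondence
import Mathlib.RingTheory.RootsOfUnity.PrimitiveRoots
import HarnessLib

/-!
# The Neukirch–Uchida deduction, row R9: Kummer separation — the correspondence of primes induced by a
# partial isomorphism of `G_F` is ONE Galois translation on the primes over totally split places

J. Neukirch, A. Schmidt, K. Wingberg, *Cohomology of Number Fields* (2nd ed.), Thm. (12.2.1)
(Neukirch–Uchida), the «finite-level conjugacy» step of the proof; here in the elementary KUMMER form of
the abc-iut cell's sub-DAG `plan/L4/SUBDAG-NeukirchUchida.md` (row R9, «WHY R9 WORKS»), which replaces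
Uchida's Gassmann-equivalence argument.

SETTING (all at the level of `Γ = G_F = Gal(F̄/F)` acting on `F̄`; no quotient groups).  `V ⊴ Γ` (the
absolute Galois group of a finite Galois extension `N/F`), `α` an automorphism of `V`; `ζ` a primitive
`ℓ`-th root of unity and `β` an element, both fixed by `V` (i.e. in `N`); `x c` a chosen `ℓ`-th root of
each conjugate `c ∈ Γ • β`; `W ≤ V` a subgroup fixing all the `x c` (the absolute Galois group of the Kummer
field `M = N(x c : c)`), with `α(W) = W` (row R6 at `M`) and the Kummer bound `[C_c : W] ∣ ℓ` for the
«root-fixing subgroup off `c`» `C_c = V ∩ ⋂_{c' ≠ c} Stab(x c')` (row R8 (K2)).  For a nonarchimedean prime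
`A` of `F̄` (a valuation subring, `D_A` = its stabiliser = decomposition group) at which `ℓ` is a unit and
`g • β ≡ 1 (mod 𝔪_A)` for all `g ∉ V` (Chinese-remainder data, row R8 (K4)), and at which some element of
`D_A ∩ V` MOVES `x β` (a Frobenius, rows R3.5 + R8 (K3′)):

* `stabilizer_inf_le_of_forall_sub_one_mem`: `D_A ∩ V ≤ C_β` — from the FIXEDNESS lemma (row R8 (K3):
  `σ ∈ D_A` fixing `ζ`, `ℓ ∈ A^×`, `y^ℓ = b`, `σ b = b`, `b ≡ 1 (mod 𝔪_A)` ⇒ `σ y = y`), which enters as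
  the hypothesis `hfix`;
* `stabilizer_inf_sup_eq_of_exists_smul_ne`: `(D_A ∩ V) · W = C_β` (index squeeze: `W ≤ (D_A ∩ V)·W ≤ C_β`,
  `[C_β : W] ∣ ℓ` prime, and the mover is not in `W`);
* `forall_sub_one_mem_nonunits_smul`, `exists_mover_smul`: the data transport from `A` to `m • A` (with
  `β` replaced by `m • β`), so that `(D_{m•A} ∩ V) · W = C_{m•β}`;
* `map_stabilizer_inf_sup_subgroupOf`: `α((D_A ∩ V)·W) = (D_{A'} ∩ V)·W` whenever `α(D_A ∩ V) = D_{A'} ∩ V`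
  (the prime correspondence of row R1, `NeukirchUchidaPrimeCorrespondence.lean`);
* **`inv_mul_mem_of_map_stabilizer_eq`** (R9): if `α(D_{A₀} ∩ V) = D_{m₀•A₀} ∩ V` and
  `α(D_{A₁} ∩ V) = D_{m₁•A₁} ∩ V` for two such primes `A₀, A₁`, then `m₀⁻¹ m₁ ∈ V`: applying `α` to
  `(D_{A_i} ∩ V)·W = C_β` gives `C_{m₀•β} = α(C_β) = C_{m₁•β}`; a mover of `x(m₀•β)` inside `C_{m₀•β}`
  shows `m₀ • β = m₁ • β`, and `(m₀⁻¹m₁) • β = β` with `m₀⁻¹m₁ ∉ V` would give `β ≡ 1 (mod 𝔪_{A₀})`,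
  contradicting the mover at `A₀` by fixedness.

PROOF-ONLY (0 `def`s); F is any field (the number theory — existence of the movers, of `β`, of `W`'s
properties — is in the rows that discharge the hypotheses).  HONEST FRAMING: classical, outside the
[IUTchIII] Cor. 3.12 cone; the hypotheses `hfix`/`hK2`/`hαW`/movers are the outputs of rows R8/R6/R3 of
the sub-DAG and are NOT proved here; nothing here takes a side.

## References
* [NeukirchSchmidtWingberg2008] Neukirch–Schmidt–Wingberg, *Cohomology of Number Fields*, Thm. (12.2.1).
* [SerreLocalFields1979] J.-P. Serre, *Local Fields*, Ch. I §7 (valuation rings, units and non-units).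
-/

noncomputable section

open scoped Pointwise
open Field

namespace Literature.AnabelianGeometry.AbsoluteAnabelian

namespace NeukirchUchidaProof

section General

variable {F : Type} [Field F]

/-- The non-units of a valuation subring `A` of a field: `y ∈ 𝔪_A ∪ {0}`-set iff `y = 0` or
`y⁻¹ ∉ A` (valuation `< 1` iff the inverse has valuation `> 1`).
[cite: SerreLocalFields1979, Ch. I §7] -/
theorem mem_nonunits_iff_eq_zero_or_inv_not_mem (A : ValuationSubring (AlgebraicClosure F))
    (y : AlgebraicClosure F) : y ∈ A.nonunits ↔ y = 0 ∨ y⁻¹ ∉ A := by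
  rw [ValuationSubring.mem_nonunits_iff]
  constructor
  · intro h
    by_cases hy : y = 0
    · exact Or.inl hy
    · right
      intro hmem
      have h1 := (A.valuation_le_one_iff _).mpr hmem
      rw [map_inv₀] at h1
      have h2 : A.valuation y ≠ 0 := by
        intro h0
        exact hy ((map_eq_zero _).mp h0)
      have : (1 : _) < (A.valuation y)⁻¹ := one_lt_inv_iff₀.mpr ⟨lt_of_le_of_ne zero_le h2.symm, h⟩
      exact absurd h1 (not_le.mpr this)
  · rintro (rfl | h)
    · simp
    · by_contra hlt
      rw [not_lt] at hlt
      apply h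
      rw [← A.valuation_le_one_iff, map_inv₀]
      exact inv_le_one_of_one_le₀ hlt

/-- Transport of non-units under the Galois action on valuation subrings: `y ∈ 𝔪_{σ•A}` iff
`σ⁻¹ y ∈ 𝔪_A`. [cite: SerreLocalFields1979, Ch. I §7] -/
theorem mem_nonunits_smul_iff (σ : absoluteGaloisGroup F) (A : ValuationSubring (AlgebraicClosure F))
    (y : AlgebraicClosure F) : y ∈ (σ • A).nonunits ↔ σ⁻¹ • y ∈ A.nonunits := by
  rw [mem_nonunits_iff_eq_zero_or_inv_not_mem, mem_nonunits_iff_eq_zero_or_inv_not_mem,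
    ValuationSubring.mem_pointwise_smul_iff_inv_smul_mem, smul_inv'', smul_eq_zero_iff_eq]

/-- Membership in the «root-fixing subgroup off `c`»: `σ ∈ V ⊓ ⨅_{c' ∈ O, c' ≠ c} Stab(x c')` iff `σ ∈ V`
and `σ` fixes every chosen root `x c'`, `c' ∈ O`, `c' ≠ c`. [folklore] -/
private theorem mem_inf_iInf_stabilizer_iff (V : Subgroup (absoluteGaloisGroup F))
    (O : Set (AlgebraicClosure F)) (x : AlgebraicClosure F → AlgebraicClosure F)
    (c : AlgebraicClosure F) (σ : absoluteGaloisGroup F) :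
    σ ∈ V ⊓ ⨅ c' ∈ O \ {c}, MulAction.stabilizer (absoluteGaloisGroup F) (x c') ↔
      σ ∈ V ∧ ∀ c' ∈ O, c' ≠ c → σ • x c' = x c' := by
  simp only [Subgroup.mem_inf, Subgroup.mem_iInf, Set.mem_sdiff, Set.mem_singleton_iff,
    MulAction.mem_stabilizer_iff, and_imp]

/-- For subgroups `X, Y ≤ V`: `(X ⊔ Y) ∩ V = (X ∩ V) ⊔ (Y ∩ V)` inside `V`. [folklore] -/
private theorem subgroupOf_sup_of_le {G : Type*} [Group G] {V X Y : Subgroup G} (hX : X ≤ V)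
    (hY : Y ≤ V) : (X ⊔ Y).subgroupOf V = X.subgroupOf V ⊔ Y.subgroupOf V := by
  have hXr : X ≤ V.subtype.range := by rwa [Subgroup.range_subtype]
  have hYr : Y ≤ V.subtype.range := by rwa [Subgroup.range_subtype]
  exact (Subgroup.comap_sup_eq_of_le_range V.subtype hXr hYr).symm

/-- **Index squeeze**: `W ≤ H ≤ C` with `[C : W]` dividing a prime `ℓ` and `H ≰ W` forces `H = C`.
[folklore] -/
private theorem eq_of_relIndex_dvd_prime {G : Type*} [Group G] {W H C : Subgroup G} (hWH : W ≤ H)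
    (hHC : H ≤ C) {ℓ : ℕ} (hℓ : ℓ.Prime) (hdvd : W.relIndex C ∣ ℓ) (hnot : ¬ H ≤ W) : H = C := by
  have hmul := Subgroup.relIndex_mul_relIndex W H C hWH hHC
  have hWC : W.relIndex C ≠ 1 := by
    intro h1
    rw [Subgroup.relIndex_eq_one] at h1
    exact hnot (hHC.trans h1)
  have hWCℓ : W.relIndex C = ℓ := ((Nat.dvd_prime hℓ).mp hdvd).resolve_left hWC
  rw [hWCℓ] at hmul
  have hWH1 : W.relIndex H ≠ 1 := by
    intro h1
    rw [Subgroup.relIndex_eq_one] at h1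
    exact hnot h1
  have hWHdvd : W.relIndex H ∣ ℓ := Dvd.intro _ hmul
  have hWHℓ : W.relIndex H = ℓ := ((Nat.dvd_prime hℓ).mp hWHdvd).resolve_left hWH1
  rw [hWHℓ] at hmul
  have hHC1 : H.relIndex C = 1 := by
    have := hmul
    nth_rewrite 2 [← Nat.mul_one ℓ] at this
    exact Nat.eq_of_mul_eq_mul_left hℓ.pos this
  rw [Subgroup.relIndex_eq_one] at hHC1
  exact le_antisymm hHC hHC1

section Separation

variable {V : Subgroup (absoluteGaloisGroup F)}

/-- A NORMAL subgroup fixing `β` fixes every conjugate of `β`. [folklore] -/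
private theorem smul_eq_self_of_mem_orbit [V.Normal] {β : AlgebraicClosure F}
    (hβV : ∀ σ ∈ V, σ • β = β) {σ : absoluteGaloisGroup F} (hσ : σ ∈ V)
    {c : AlgebraicClosure F} (hc : c ∈ MulAction.orbit (absoluteGaloisGroup F) β) : σ • c = c := by
  obtain ⟨g, rfl⟩ := hc
  have h : g⁻¹ * σ * g ∈ V := by
    have := Subgroup.Normal.conj_mem inferInstance σ hσ g⁻¹
    simpa using this
  calc σ • g • β = g • ((g⁻¹ * σ * g) • β) := by simp [mul_smul]
    _ = g • β := by rw [hβV _ h]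

/-- **Kummer**: an element of `V` (fixing `ζ_ℓ` and the conjugates of `β`) multiplies a chosen `ℓ`-th
root of a conjugate by an `ℓ`-th root of unity `ζ^i`. [cite: NeukirchSchmidtWingberg2008, Thm (12.2.1)] -/
private theorem exists_smul_root_eq_pow_mul [V.Normal] {ℓ : ℕ} (hℓ : 0 < ℓ) {ζ β : AlgebraicClosure F}
    (hζ : IsPrimitiveRoot ζ ℓ) (hβV : ∀ σ ∈ V, σ • β = β)
    {x : AlgebraicClosure F → AlgebraicClosure F}
    (hx : ∀ c ∈ MulAction.orbit (absoluteGaloisGroup F) β, x c ^ ℓ = c)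
    {σ : absoluteGaloisGroup F} (hσ : σ ∈ V) {c : AlgebraicClosure F}
    (hc : c ∈ MulAction.orbit (absoluteGaloisGroup F) β) : ∃ i : ℕ, σ • x c = ζ ^ i * x c := by
  by_cases h0 : x c = 0
  · refine ⟨0, ?_⟩
    rw [h0, smul_zero, mul_zero]
  · haveI : NeZero ℓ := ⟨hℓ.ne'⟩
    have hpow : (σ • x c * (x c)⁻¹) ^ ℓ = 1 := by
      have hcℓ : x c ^ ℓ ≠ 0 := pow_ne_zero _ h0
      calc (σ • x c * (x c)⁻¹) ^ ℓ = σ • (x c ^ ℓ) * (x c ^ ℓ)⁻¹ := by rw [mul_pow, inv_pow, smul_pow']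
        _ = 1 := by rw [hx c hc, smul_eq_self_of_mem_orbit hβV hσ hc, ← hx c hc, mul_inv_cancel₀ hcℓ]
    obtain ⟨i, -, hi⟩ := hζ.eq_pow_of_pow_eq_one hpow
    refine ⟨i, ?_⟩
    rw [hi, inv_mul_cancel_right₀ h0]

variable [V.Normal] {ℓ : ℕ} {ζ β : AlgebraicClosure F} {x : AlgebraicClosure F → AlgebraicClosure F}
  {W : Subgroup (absoluteGaloisGroup F)}

/-- **The decomposition group fixes the roots off its own prime** (inclusion `D_A ∩ V ≤ C_c`): if every
conjugate `c' ≠ c` of `β` satisfies `c' ≡ 1 mod 𝔪_A` and `ℓ` is a unit of `A`, then every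
`σ ∈ D_A ∩ V` fixes the roots `x c'`, `c' ≠ c` (from the fixedness lemma `hfix`, SUBDAG R8 (K3)).
[cite: NeukirchSchmidtWingberg2008, Thm (12.2.1)] -/
theorem stabilizer_inf_le_of_forall_sub_one_mem
    (hζV : ∀ σ ∈ V, σ • ζ = ζ) (hβV : ∀ σ ∈ V, σ • β = β)
    (hx : ∀ c ∈ MulAction.orbit (absoluteGaloisGroup F) β, x c ^ ℓ = c)
    (hfix : ∀ (A : ValuationSubring (AlgebraicClosure F)) (σ : absoluteGaloisGroup F), σ • A = A →
      σ • ζ = ζ → ((ℓ : ℕ) : AlgebraicClosure F) ∉ A.nonunits →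
      ∀ y b : AlgebraicClosure F, y ^ ℓ = b → σ • b = b → b - 1 ∈ A.nonunits → σ • y = y)
    (A : ValuationSubring (AlgebraicClosure F)) (hℓA : ((ℓ : ℕ) : AlgebraicClosure F) ∉ A.nonunits)
    (c : AlgebraicClosure F)
    (hA : ∀ c' ∈ MulAction.orbit (absoluteGaloisGroup F) β, c' ≠ c → c' - 1 ∈ A.nonunits) :
    MulAction.stabilizer (absoluteGaloisGroup F) A ⊓ V ≤
      V ⊓ ⨅ c' ∈ MulAction.orbit (absoluteGaloisGroup F) β \ {c},
        MulAction.stabilizer (absoluteGaloisGroup F) (x c') := by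
  intro σ hσ
  rw [mem_inf_iInf_stabilizer_iff]
  refine ⟨hσ.2, fun c' hc' hne => ?_⟩
  exact hfix A σ hσ.1 (hζV σ hσ.2) hℓA (x c') c' (hx c' hc') (smul_eq_self_of_mem_orbit hβV hσ.2 hc')
    (hA c' hc' hne)

/-- **`(D_A ∩ V) · W = C_c`**: with the hypotheses of `stabilizer_inf_le_of_forall_sub_one_mem`, if
`W ≤ V` fixes all the roots, `[C_c : W] ∣ ℓ` (the Kummer character, SUBDAG R8 (K2)) and some element
of `D_A ∩ V` MOVES `x c` (a Frobenius, R8 (K3′)), then `(D_A ∩ V) ⊔ W` is the whole root-fixing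
subgroup `C_c` off `c`. [cite: NeukirchSchmidtWingberg2008, Thm (12.2.1)] -/
theorem stabilizer_inf_sup_eq_of_exists_smul_ne (hℓ : ℓ.Prime)
    (hζV : ∀ σ ∈ V, σ • ζ = ζ) (hβV : ∀ σ ∈ V, σ • β = β)
    (hx : ∀ c ∈ MulAction.orbit (absoluteGaloisGroup F) β, x c ^ ℓ = c)
    (hfix : ∀ (A : ValuationSubring (AlgebraicClosure F)) (σ : absoluteGaloisGroup F), σ • A = A →
      σ • ζ = ζ → ((ℓ : ℕ) : AlgebraicClosure F) ∉ A.nonunits →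
      ∀ y b : AlgebraicClosure F, y ^ ℓ = b → σ • b = b → b - 1 ∈ A.nonunits → σ • y = y)
    (hWV : W ≤ V) (hWx : ∀ w ∈ W, ∀ c' ∈ MulAction.orbit (absoluteGaloisGroup F) β, w • x c' = x c')
    (A : ValuationSubring (AlgebraicClosure F)) (hℓA : ((ℓ : ℕ) : AlgebraicClosure F) ∉ A.nonunits)
    {c : AlgebraicClosure F} (hc : c ∈ MulAction.orbit (absoluteGaloisGroup F) β)
    (hA : ∀ c' ∈ MulAction.orbit (absoluteGaloisGroup F) β, c' ≠ c → c' - 1 ∈ A.nonunits)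
    (hK2 : W.relIndex (V ⊓ ⨅ c' ∈ MulAction.orbit (absoluteGaloisGroup F) β \ {c},
        MulAction.stabilizer (absoluteGaloisGroup F) (x c')) ∣ ℓ)
    (hmove : ∃ φ ∈ MulAction.stabilizer (absoluteGaloisGroup F) A ⊓ V, φ • x c ≠ x c) :
    MulAction.stabilizer (absoluteGaloisGroup F) A ⊓ V ⊔ W =
      V ⊓ ⨅ c' ∈ MulAction.orbit (absoluteGaloisGroup F) β \ {c},
        MulAction.stabilizer (absoluteGaloisGroup F) (x c') := by
  refine eq_of_relIndex_dvd_prime le_sup_right ?_ hℓ hK2 ?_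
  · refine sup_le (stabilizer_inf_le_of_forall_sub_one_mem hζV hβV hx hfix A hℓA c hA) ?_
    intro w hw
    rw [mem_inf_iInf_stabilizer_iff]
    exact ⟨hWV hw, fun c' hc' _ => hWx w hw c' hc'⟩
  · intro hle
    obtain ⟨φ, hφ, hφx⟩ := hmove
    exact hφx (hWx φ (hle (Subgroup.mem_sup_left hφ)) c hc)

omit [V.Normal] in
/-- Transport of the congruences `c' ≡ 1 (mod 𝔪_A)` from `A` to `m • A`: if `g • β ≡ 1 (mod 𝔪_A)` for
every `g ∉ V`, then every conjugate `c' ≠ m • β` satisfies `c' ≡ 1 (mod 𝔪_{m • A})`.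
[cite: NeukirchSchmidtWingberg2008, Thm (12.2.1)] -/
theorem forall_sub_one_mem_nonunits_smul (hβV : ∀ σ ∈ V, σ • β = β)
    {A : ValuationSubring (AlgebraicClosure F)}
    (hβ : ∀ g : absoluteGaloisGroup F, g ∉ V → g • β - 1 ∈ A.nonunits) (m : absoluteGaloisGroup F) :
    ∀ c' ∈ MulAction.orbit (absoluteGaloisGroup F) β, c' ≠ m • β → c' - 1 ∈ (m • A).nonunits := by
  rintro c' ⟨g, rfl⟩ hne
  have hg : m⁻¹ * g ∉ V := by
    intro h
    apply hne
    change g • β = m • β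
    rw [show g = m * (m⁻¹ * g) by group, mul_smul, hβV _ h]
  have h := hβ (m⁻¹ * g) hg
  rw [mem_nonunits_smul_iff]
  change m⁻¹ • (g • β - 1) ∈ A.nonunits
  rwa [smul_sub, smul_one, smul_smul]

/-- `ℓ` is a unit of `m • A` iff it is a unit of `A` (a rational integer is fixed by `G_F`). [folklore] -/
private theorem natCast_not_mem_nonunits_smul {A : ValuationSubring (AlgebraicClosure F)} {n : ℕ}
    (h : ((n : ℕ) : AlgebraicClosure F) ∉ A.nonunits) (m : absoluteGaloisGroup F) :
    ((n : ℕ) : AlgebraicClosure F) ∉ (m • A).nonunits := by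
  rw [mem_nonunits_smul_iff]
  have : m⁻¹ • ((n : ℕ) : AlgebraicClosure F) = n :=
    map_natCast (MulSemiringAction.toRingHom (absoluteGaloisGroup F) (AlgebraicClosure F) m⁻¹) n
  rwa [this]

/-- Transport of a MOVER: if some `φ ∈ D_A ∩ V` moves the root `x β`, then `m φ m⁻¹ ∈ D_{m•A} ∩ V` moves
the root `x (m • β)` (the two `ℓ`-th roots `x (m • β)` and `m • x β` of `m • β` differ by a power of
`ζ`, which `V` fixes). [cite: NeukirchSchmidtWingberg2008, Thm (12.2.1)] -/
theorem exists_mover_smul (hℓ : 0 < ℓ) (hζ : IsPrimitiveRoot ζ ℓ) (hζV : ∀ σ ∈ V, σ • ζ = ζ)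
    (hx : ∀ c ∈ MulAction.orbit (absoluteGaloisGroup F) β, x c ^ ℓ = c)
    {A : ValuationSubring (AlgebraicClosure F)}
    (hmove : ∃ φ ∈ MulAction.stabilizer (absoluteGaloisGroup F) A ⊓ V, φ • x β ≠ x β)
    (m : absoluteGaloisGroup F) :
    ∃ φ ∈ MulAction.stabilizer (absoluteGaloisGroup F) (m • A) ⊓ V, φ • x (m • β) ≠ x (m • β) := by
  obtain ⟨φ, hφ, hφx⟩ := hmove
  haveI : NeZero ℓ := ⟨hℓ.ne'⟩
  have hstab : m * φ * m⁻¹ ∈ MulAction.stabilizer (absoluteGaloisGroup F) (m • A) := by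
    rw [MulAction.mem_stabilizer_iff, mul_smul, mul_smul, inv_smul_smul,
      MulAction.mem_stabilizer_iff.mp hφ.1]
  refine ⟨m * φ * m⁻¹, Subgroup.mem_inf.mpr ⟨hstab, Subgroup.Normal.conj_mem inferInstance φ hφ.2 m⟩,
    ?_⟩
  · -- `x β ≠ 0`
    have hxβ : x β ≠ 0 := by
      intro h0
      exact hφx (by rw [h0, smul_zero])
    have hβorb : β ∈ MulAction.orbit (absoluteGaloisGroup F) β := MulAction.mem_orbit_self β
    have hmβ : m • β ∈ MulAction.orbit (absoluteGaloisGroup F) β := ⟨m, rfl⟩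
    -- `x (m • β) = ζ^i * m • x β`
    have hpow : (x (m • β) * (m • x β)⁻¹) ^ ℓ = 1 := by
      have h1 : (m • x β) ^ ℓ = m • β := by rw [← smul_pow', hx β hβorb]
      have h2 : (m • x β) ^ ℓ ≠ 0 := pow_ne_zero _ (by rwa [Ne, smul_eq_zero_iff_eq])
      rw [mul_pow, inv_pow, hx _ hmβ, ← h1, mul_inv_cancel₀ h2]
    obtain ⟨i, -, hi⟩ := hζ.eq_pow_of_pow_eq_one hpow
    have hxm : x (m • β) = ζ ^ i * m • x β := by
      rw [hi, inv_mul_cancel_right₀ (by rwa [Ne, smul_eq_zero_iff_eq])]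
    intro heq
    apply hφx
    have hV : m * φ * m⁻¹ ∈ V := Subgroup.Normal.conj_mem inferInstance φ hφ.2 m
    have hζi : (m * φ * m⁻¹) • ζ ^ i = ζ ^ i := by rw [smul_pow', hζV _ hV]
    rw [hxm, smul_mul', hζi, mul_smul, mul_smul, inv_smul_smul] at heq
    have hζ0 : ζ ^ i ≠ 0 := pow_ne_zero _ (hζ.ne_zero hℓ.ne')
    have heq' : m • φ • x β = m • x β := mul_left_cancel₀ hζ0 heq
    exact (smul_left_cancel_iff m).mp heq'

/-- Injectivity helper: subgroups contained in `V` with the same trace on `V` are equal. [folklore] -/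
private theorem eq_of_subgroupOf_eq {G : Type*} [Group G] {V X Y : Subgroup G} (hX : X ≤ V) (hY : Y ≤ V)
    (h : X.subgroupOf V = Y.subgroupOf V) : X = Y := by
  rw [Subgroup.subgroupOf_inj, inf_eq_left.mpr hX, inf_eq_left.mpr hY] at h
  exact h

omit [V.Normal] in
/-- **Transport of `(D_A ∩ V) · W` under `α`**: if `α(D_A ∩ V) = D_{A'} ∩ V` (the prime correspondence, row
R1) and `α(W) = W` (row R6 at the Kummer field), then `α((D_A ∩ V) ⊔ W) = (D_{A'} ∩ V) ⊔ W` inside `V`.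
[cite: NeukirchSchmidtWingberg2008, Thm (12.2.1)] -/
theorem map_stabilizer_inf_sup_subgroupOf (α : V ≃* V) (hWV : W ≤ V)
    (hαW : (W.subgroupOf V).map α.toMonoidHom = W.subgroupOf V)
    {A A' : ValuationSubring (AlgebraicClosure F)}
    (hπ : ((MulAction.stabilizer (absoluteGaloisGroup F) A).subgroupOf V).map α.toMonoidHom =
      (MulAction.stabilizer (absoluteGaloisGroup F) A').subgroupOf V) :
    ((MulAction.stabilizer (absoluteGaloisGroup F) A ⊓ V ⊔ W).subgroupOf V).map α.toMonoidHom =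
      (MulAction.stabilizer (absoluteGaloisGroup F) A' ⊓ V ⊔ W).subgroupOf V := by
  rw [subgroupOf_sup_of_le inf_le_right hWV, subgroupOf_sup_of_le inf_le_right hWV, Subgroup.map_sup,
    Subgroup.inf_subgroupOf_right, Subgroup.inf_subgroupOf_right, hπ, hαW]

/-- **Kummer separation** ([NSW] (12.2.1), the «finite-level conjugacy» step, in the elementary Kummer
form of `plan/L4/SUBDAG-NeukirchUchida.md` row R9).  Setting: `V ⊴ G_F` of finite index (the absolute
Galois group of a finite Galois extension `N`), `α` an automorphism of `V`, `ζ` a primitive `ℓ`-th root of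
unity and `β` fixed by `V`, chosen `ℓ`-th roots `x c` of the conjugates `c` of `β`, `W ≤ V` fixing them
(the absolute Galois group of the Kummer field) with `α(W) = W` and the Kummer bound `[C_c : W] ∣ ℓ`;
two nonarchimedean primes `A₀`, `A₁` of `F̄` at which `ℓ` is a unit, at which `g • β ≡ 1` for all
`g ∉ V` (Chinese remainder data) and at which some element of `D ∩ V` moves `x β`; and the prime
correspondence `α(D_{A_i} ∩ V) = D_{m_i • A_i} ∩ V`.  CONCLUSION: `m₀⁻¹ m₁ ∈ V` — the translation
classes of the two primes under the correspondence COINCIDE.  The fixedness lemma (row R8 (K3)) enters as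
the hypothesis `hfix`. [cite: NeukirchSchmidtWingberg2008, Thm (12.2.1)] -/
theorem inv_mul_mem_of_map_stabilizer_eq (hℓ : ℓ.Prime) (hζ : IsPrimitiveRoot ζ ℓ)
    (hζV : ∀ σ ∈ V, σ • ζ = ζ) (hβV : ∀ σ ∈ V, σ • β = β)
    (hx : ∀ c ∈ MulAction.orbit (absoluteGaloisGroup F) β, x c ^ ℓ = c)
    (hfix : ∀ (A : ValuationSubring (AlgebraicClosure F)) (σ : absoluteGaloisGroup F), σ • A = A →
      σ • ζ = ζ → ((ℓ : ℕ) : AlgebraicClosure F) ∉ A.nonunits →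
      ∀ y b : AlgebraicClosure F, y ^ ℓ = b → σ • b = b → b - 1 ∈ A.nonunits → σ • y = y)
    (hWV : W ≤ V) (hWx : ∀ w ∈ W, ∀ c' ∈ MulAction.orbit (absoluteGaloisGroup F) β, w • x c' = x c')
    (hK2 : ∀ c ∈ MulAction.orbit (absoluteGaloisGroup F) β,
      W.relIndex (V ⊓ ⨅ c' ∈ MulAction.orbit (absoluteGaloisGroup F) β \ {c},
        MulAction.stabilizer (absoluteGaloisGroup F) (x c')) ∣ ℓ)
    (α : V ≃* V) (hαW : (W.subgroupOf V).map α.toMonoidHom = W.subgroupOf V)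
    {A₀ A₁ : ValuationSubring (AlgebraicClosure F)}
    (hℓ₀ : ((ℓ : ℕ) : AlgebraicClosure F) ∉ A₀.nonunits) (hℓ₁ : ((ℓ : ℕ) : AlgebraicClosure F) ∉ A₁.nonunits)
    (hβ₀ : ∀ g : absoluteGaloisGroup F, g ∉ V → g • β - 1 ∈ A₀.nonunits)
    (hβ₁ : ∀ g : absoluteGaloisGroup F, g ∉ V → g • β - 1 ∈ A₁.nonunits)
    (hmove₀ : ∃ φ ∈ MulAction.stabilizer (absoluteGaloisGroup F) A₀ ⊓ V, φ • x β ≠ x β)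
    (hmove₁ : ∃ φ ∈ MulAction.stabilizer (absoluteGaloisGroup F) A₁ ⊓ V, φ • x β ≠ x β)
    {m₀ m₁ : absoluteGaloisGroup F}
    (hπ₀ : ((MulAction.stabilizer (absoluteGaloisGroup F) A₀).subgroupOf V).map α.toMonoidHom =
      (MulAction.stabilizer (absoluteGaloisGroup F) (m₀ • A₀)).subgroupOf V)
    (hπ₁ : ((MulAction.stabilizer (absoluteGaloisGroup F) A₁).subgroupOf V).map α.toMonoidHom =
      (MulAction.stabilizer (absoluteGaloisGroup F) (m₁ • A₁)).subgroupOf V) :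
    m₀⁻¹ * m₁ ∈ V := by
  have hβorb : β ∈ MulAction.orbit (absoluteGaloisGroup F) β := MulAction.mem_orbit_self β
  -- the four equalities `(D ∩ V) ⊔ W = C`
  have key : ∀ (A : ValuationSubring (AlgebraicClosure F)) (m : absoluteGaloisGroup F),
      ((ℓ : ℕ) : AlgebraicClosure F) ∉ A.nonunits →
      (∀ g : absoluteGaloisGroup F, g ∉ V → g • β - 1 ∈ A.nonunits) →
      (∃ φ ∈ MulAction.stabilizer (absoluteGaloisGroup F) A ⊓ V, φ • x β ≠ x β) →
      MulAction.stabilizer (absoluteGaloisGroup F) (m • A) ⊓ V ⊔ W =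
        V ⊓ ⨅ c' ∈ MulAction.orbit (absoluteGaloisGroup F) β \ {m • β},
          MulAction.stabilizer (absoluteGaloisGroup F) (x c') := by
    intro A m hℓA hβA hmoveA
    exact stabilizer_inf_sup_eq_of_exists_smul_ne hℓ hζV hβV hx hfix hWV hWx (m • A)
      (natCast_not_mem_nonunits_smul hℓA m) ⟨m, rfl⟩ (forall_sub_one_mem_nonunits_smul hβV hβA m)
      (hK2 _ ⟨m, rfl⟩) (exists_mover_smul hℓ.pos hζ hζV hx hmoveA m)
  have e₀ := key A₀ 1 hℓ₀ hβ₀ hmove₀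
  have e₁ := key A₁ 1 hℓ₁ hβ₁ hmove₁
  have e₀' := key A₀ m₀ hℓ₀ hβ₀ hmove₀
  have e₁' := key A₁ m₁ hℓ₁ hβ₁ hmove₁
  rw [one_smul, one_smul] at e₀ e₁
  -- transport under `α`
  have t₀ := map_stabilizer_inf_sup_subgroupOf α hWV hαW hπ₀
  have t₁ := map_stabilizer_inf_sup_subgroupOf α hWV hαW hπ₁
  rw [e₀, e₀'] at t₀
  rw [e₁, e₁'] at t₁
  rw [t₀] at t₁
  -- hence `C (m₀ • β) = C (m₁ • β)`
  have hC : (V ⊓ ⨅ c' ∈ MulAction.orbit (absoluteGaloisGroup F) β \ {m₀ • β},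
        MulAction.stabilizer (absoluteGaloisGroup F) (x c')) =
      V ⊓ ⨅ c' ∈ MulAction.orbit (absoluteGaloisGroup F) β \ {m₁ • β},
        MulAction.stabilizer (absoluteGaloisGroup F) (x c') :=
    eq_of_subgroupOf_eq inf_le_left inf_le_left t₁
  -- a mover at `m₀ • A₀` lies in `C (m₀ • β) = C (m₁ • β)`, so `m₀ • β = m₁ • β`
  obtain ⟨φ, hφ, hφx⟩ := exists_mover_smul hℓ.pos hζ hζV hx hmove₀ m₀
  have hφC : φ ∈ V ⊓ ⨅ c' ∈ MulAction.orbit (absoluteGaloisGroup F) β \ {m₁ • β},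
      MulAction.stabilizer (absoluteGaloisGroup F) (x c') := by
    rw [← hC, ← e₀']
    exact Subgroup.mem_sup_left hφ
  rw [mem_inf_iInf_stabilizer_iff] at hφC
  have hmβ : m₀ • β = m₁ • β := by
    by_contra hne
    exact hφx (hφC.2 (m₀ • β) ⟨m₀, rfl⟩ hne)
  -- finally `(m₀⁻¹ m₁) • β = β` forces `m₀⁻¹ m₁ ∈ V`
  by_contra hnot
  have h1 : (m₀⁻¹ * m₁) • β - 1 ∈ A₀.nonunits := hβ₀ _ hnot
  rw [mul_smul, ← hmβ, inv_smul_smul] at h1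
  obtain ⟨φ₀, hφ₀, hφ₀x⟩ := hmove₀
  exact hφ₀x (hfix A₀ φ₀ hφ₀.1 (hζV φ₀ hφ₀.2) hℓ₀ (x β) β (hx β hβorb) (hβV φ₀ hφ₀.2) h1)

end Separation

end General


end NeukirchUchidaProof

end Literature.AnabelianGeometry.AbsoluteAnabelian

end
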